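import Mathlib.Analysis.SpecialFunctions.Log.Base
import Mathlib.Analysis.SpecialFunctions.Pow.Real
import Mathlib.Analysis.SpecialFunctions.Trigonometric.Bounds
import Mathlib.Analysis.SpecialFunctions.Sqrt
import Mathlib.Analysis.Complex.ExponentialBounds
import Mathlib.Analysis.Real.Pi.Bounds
import HarnessLib

/-!
# `JoiningsTransfer` (item stmt-CriticalPhenomena-18764): the three hypotheses of the two-base Croft
lemma are load-bearing

Negative / structural knowledge for the crux
`Summit.CriticalPhenomena.Ising3DConformalLimit.Theses.SynchronousCoupling.JoiningsTransfer` (standing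
crux disprover, cycle 1, D-0016); THEOREM-ONLY, pure Mathlib (mutated statements and witnesses inline).
The abstract skeleton of the transfer `DilationJoinings → … → (PL)` (proof plan "Cauchy along `b·p^j`,
`log 2/log 3 ∉ ℚ` gives the full filter", Kozma2007 §6.1; crux idea `towers-to-all-scales-croft`, first
lemma `TwoBaseCroft`) is the TWO-BASE CROFT LEMMA for `R : ℕ → ℝ` (`R L = R_n(L;k⃗)`, the critical block
moments): (T₂) `|R(2L) − R(L)| ≤ C·L^{-θ}`, (T₃) `|R(3L) − R(L)| ≤ C·L^{-θ}` (`L ≥ 1`, `θ > 0`) and (LC)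
`∀ ε>0 ∃ s>0 ∃ L₀ ∀ L₀ ≤ L ≤ L' ≤ (1+s)L, |R L' − R L| ≤ ε` ⟹ `R` converges. Each hypothesis is NECESSARY:
* `not_twoBaseCroft_without_three` — drop (T₃): `cos (2π log₂ L)` is exactly `2`-self-similar,
  log-Lipschitz and divergent (`= 1` at `2^k`, `= cos (2π log₂ 3) ≠ 1` at `3·2^k`, as `1 < log₂ 3 < 2`);
* `not_twoBaseCroft_without_logContinuity` — drop (LC): the indicator of `{2^i 3^j}` is exactly
  invariant under BOTH `L ↦ 2L, 3L` and divergent (`1` at `2^k`, `0` at `5·2^k`);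
* `not_twoBaseCroft_littleO` — power rate weakened to `o(1)` steps: `cos (π √(log₂ L))` has
  `R(pL) − R(L) → 0` for EVERY `p ≥ 1`, satisfies (LC), and diverges (`R(2^{n²}) = (−1)ⁿ`) — the abstract
  form of the why-line failure mode of `DilationJoinings` "o(1) defect but no power rate".
[folklore]
-/
noncomputable section

namespace Summit.CriticalPhenomena.Ising3DConformalLimit.JoiningsTransferNegative

open Filter Set
open scoped Topology

/-! ### Shared arithmetic -/

/-- `1 < log₂ 3`. [folklore] -/
theorem one_lt_logb_two_three : 1 < Real.logb 2 3 := by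
  rw [Real.lt_logb_iff_rpow_lt one_lt_two (by norm_num)]
  norm_num

/-- `log₂ 3 < 2`. [folklore] -/
theorem logb_two_three_lt_two : Real.logb 2 3 < 2 := by
  rw [Real.logb_lt_iff_lt_rpow one_lt_two (by norm_num)]
  norm_num

/-- `cos (2π log₂ 3) ≠ 1`, i.e. `log₂ 3 ∉ ℤ`. [folklore] -/
theorem cos_two_pi_logb_two_three_ne_one : Real.cos (2 * Real.pi * Real.logb 2 3) ≠ 1 := by
  rw [Ne, Real.cos_eq_one_iff]
  rintro ⟨n, hn⟩
  have h1 := one_lt_logb_two_three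
  have h2 := logb_two_three_lt_two
  have hn' : (n:ℝ) = Real.logb 2 3 := by
    have hπ : (0:ℝ) < 2 * Real.pi := by positivity
    field_simp at hn
    linarith [hn]
  have h1' : (1:ℤ) < n := by exact_mod_cast (hn' ▸ h1 : (1:ℝ) < n)
  have h2' : n < (2:ℤ) := by exact_mod_cast (hn' ▸ h2 : (n:ℝ) < 2)
  omega

/-- `log₂` of a quotient of naturals in a window `L ≤ L' ≤ (1+s)L` is at most `s / log 2`. [folklore] -/
theorem logb_two_window_le {L L' : ℕ} {s : ℝ} (hs : 0 < s) (hL : 1 ≤ L) (hLL' : L ≤ L')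
    (hL's : (L':ℝ) ≤ (1 + s) * L) :
    Real.logb 2 L' - Real.logb 2 L ≤ s / Real.log 2 := by
  have hL0 : (0:ℝ) < L := by exact_mod_cast hL
  have hL'0 : (0:ℝ) < L' := by exact_mod_cast (le_trans hL hLL')
  calc Real.logb 2 L' - Real.logb 2 L = Real.logb 2 ((L':ℝ) / L) := by
        rw [Real.logb_div hL'0.ne' hL0.ne']
    _ ≤ Real.logb 2 (1 + s) := by
        refine Real.logb_le_logb_of_le one_lt_two (by positivity) ?_
        rw [div_le_iff₀ hL0]
        exact hL's
    _ = Real.log (1 + s) / Real.log 2 := by rw [Real.logb]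
    _ ≤ s / Real.log 2 := by
        refine div_le_div_of_nonneg_right ?_ (Real.log_pos one_lt_two).le
        have := Real.log_le_sub_one_of_pos (show (0:ℝ) < 1 + s by positivity)
        linarith

/-! ### Mutation 1 — the base `3` dropped: `cos (2π log₂ L)` -/

/-- `cos (2π log₂ ·)` is exactly `2`-self-similar on `L ≥ 1`. [folklore] -/
theorem cosLog_two_mul {L : ℕ} (hL : 1 ≤ L) :
    Real.cos (2 * Real.pi * Real.logb 2 ((2 * L : ℕ) : ℝ)) = Real.cos (2 * Real.pi * Real.logb 2 (L : ℝ)) := by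
  have hL' : (0:ℝ) < L := by exact_mod_cast hL
  rw [Nat.cast_mul, Nat.cast_ofNat, Real.logb_mul two_ne_zero hL'.ne',
    Real.logb_self_eq_one one_lt_two, mul_add, mul_one, add_comm, Real.cos_add_two_pi]

/-- Value `1` along `2^k`. [folklore] -/
theorem cosLog_two_pow (k : ℕ) : Real.cos (2 * Real.pi * Real.logb 2 ((2 ^ k : ℕ) : ℝ)) = 1 := by
  rw [Nat.cast_pow, Nat.cast_ofNat, Real.logb_pow, Real.logb_self_eq_one one_lt_two, mul_one]
  have : 2 * Real.pi * (k:ℝ) = (k:ℝ) * (2 * Real.pi) := by ring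
  rw [this, Real.cos_nat_mul_two_pi]

/-- Value `cos (2π log₂ 3)` along `3·2^k`. [folklore] -/
theorem cosLog_three_mul_two_pow (k : ℕ) :
    Real.cos (2 * Real.pi * Real.logb 2 ((3 * 2 ^ k : ℕ) : ℝ)) = Real.cos (2 * Real.pi * Real.logb 2 3) := by
  rw [Nat.cast_mul, Nat.cast_pow, Nat.cast_ofNat, Nat.cast_ofNat,
    Real.logb_mul (by norm_num) (by positivity), Real.logb_pow, Real.logb_self_eq_one one_lt_two,
    mul_one, mul_add]
  have : 2 * Real.pi * (k:ℝ) = (k:ℤ) * (2 * Real.pi) := by push_cast; ring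
  rw [this, Real.cos_add_int_mul_two_pi]

/-- Log-continuity of `cos (2π log₂ ·)` (it is log-Lipschitz). [folklore] -/
theorem cosLog_logContinuous : ∀ ε : ℝ, 0 < ε → ∃ s : ℝ, 0 < s ∧ ∃ L₀ : ℕ, ∀ L L' : ℕ, L₀ ≤ L → L ≤ L' →
    (L':ℝ) ≤ (1+s)*L → |Real.cos (2 * Real.pi * Real.logb 2 (L':ℝ)) - Real.cos (2 * Real.pi * Real.logb 2 (L:ℝ))| ≤ ε := by
  intro ε hε
  refine ⟨ε / 20, by positivity, 1, fun L L' hL hLL' hL's => ?_⟩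
  have hL0 : (0:ℝ) < L := by exact_mod_cast hL
  calc |Real.cos (2 * Real.pi * Real.logb 2 L') - Real.cos (2 * Real.pi * Real.logb 2 L)|
      ≤ |2 * Real.pi * Real.logb 2 L' - 2 * Real.pi * Real.logb 2 L| := Real.abs_cos_sub_cos_le _ _
    _ = 2 * Real.pi * (Real.logb 2 L' - Real.logb 2 L) := by
        rw [← mul_sub, abs_of_nonneg]
        refine mul_nonneg (by positivity) (sub_nonneg.2 ?_)
        exact Real.logb_le_logb_of_le one_lt_two hL0 (by exact_mod_cast hLL')
    _ ≤ 2 * Real.pi * ((ε / 20) / Real.log 2) :=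
        mul_le_mul_of_nonneg_left (logb_two_window_le (by positivity) hL hLL' hL's) (by positivity)
    _ ≤ ε := by
        have hlog2 : (0.6931471803:ℝ) < Real.log 2 := Real.log_two_gt_d9
        have hπ : Real.pi < 3.15 := Real.pi_lt_d2
        rw [mul_div_assoc', div_le_iff₀ (Real.log_pos one_lt_two)]
        nlinarith [Real.pi_pos]

/-- **Witness for mutation 1.** A bounded, exactly `2`-self-similar, log-continuous real sequence that
does not converge: `R L = cos (2π log₂ L)`. [folklore] -/
theorem exists_twoSelfSimilar_logContinuous_divergent : ∃ R : ℕ → ℝ,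
    (∀ L : ℕ, |R L| ≤ 1) ∧ (∀ L : ℕ, 1 ≤ L → R (2 * L) = R L) ∧
    (∀ ε : ℝ, 0 < ε → ∃ s : ℝ, 0 < s ∧ ∃ L₀ : ℕ, ∀ L L' : ℕ, L₀ ≤ L → L ≤ L' → (L':ℝ) ≤ (1+s)*L →
      |R L' - R L| ≤ ε) ∧
    ¬ ∃ M : ℝ, Tendsto R atTop (𝓝 M) := by
  refine ⟨fun L => Real.cos (2 * Real.pi * Real.logb 2 (L:ℝ)), fun L => Real.abs_cos_le_one _,
    fun L hL => cosLog_two_mul hL, cosLog_logContinuous, ?_⟩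
  rintro ⟨M, hM⟩
  have h1 : Tendsto (fun k : ℕ => Real.cos (2 * Real.pi * Real.logb 2 ((2 ^ k : ℕ) : ℝ))) atTop (𝓝 M) :=
    hM.comp (tendsto_pow_atTop_atTop_of_one_lt one_lt_two)
  simp_rw [cosLog_two_pow] at h1
  have h3 : Tendsto (fun k : ℕ => Real.cos (2 * Real.pi * Real.logb 2 ((3 * 2 ^ k : ℕ) : ℝ))) atTop (𝓝 M) :=
    hM.comp ((tendsto_pow_atTop_atTop_of_one_lt one_lt_two).const_mul_atTop' (by norm_num : 0 < 3))
  simp_rw [cosLog_three_mul_two_pow] at h3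
  exact cos_two_pi_logb_two_three_ne_one
    ((tendsto_const_nhds_iff.1 h3).trans (tendsto_const_nhds_iff.1 h1).symm)

/-- **Mutation 1 is false: the base `3` is load-bearing.** The two-base Croft lemma with the `p = 3`
tower dropped fails (even with an EXACT `2`-tower, rate `0`). [folklore] -/
theorem not_twoBaseCroft_without_three :
    ¬ (∀ R : ℕ → ℝ, (∃ C θ : ℝ, 0 < θ ∧ ∀ L : ℕ, 1 ≤ L → |R (2*L) - R L| ≤ C * (L:ℝ)^(-θ)) →
        (∀ ε : ℝ, 0 < ε → ∃ s : ℝ, 0 < s ∧ ∃ L₀ : ℕ, ∀ L L' : ℕ, L₀ ≤ L → L ≤ L' → (L':ℝ) ≤ (1+s)*L →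
          |R L' - R L| ≤ ε) →
        ∃ M : ℝ, Tendsto R atTop (𝓝 M)) := by
  intro h
  obtain ⟨R, -, h2, hLC, hdiv⟩ := exists_twoSelfSimilar_logContinuous_divergent
  exact hdiv (h R ⟨0, 1, one_pos, fun L hL => by rw [h2 L hL, sub_self, abs_zero, zero_mul]⟩ hLC)

/-! ### Mutation 2 — log-continuity dropped: the indicator of the `3`-smooth numbers -/

/-- `2L` is `3`-smooth iff `L` is. [folklore] -/
theorem isSmooth23_two_mul_iff (L : ℕ) : (∃ i j : ℕ, 2 * L = 2 ^ i * 3 ^ j) ↔ (∃ i j : ℕ, L = 2 ^ i * 3 ^ j) := by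
  constructor
  · rintro ⟨i, j, h⟩
    rcases Nat.eq_zero_or_pos i with rfl | hi
    · exfalso
      have hodd : Odd (2 ^ 0 * 3 ^ j) := by simpa using Odd.pow (by decide : Odd 3)
      rw [← h] at hodd
      exact (Nat.not_even_iff_odd.2 hodd) (even_two_mul L)
    · refine ⟨i - 1, j, ?_⟩
      have : 2 ^ i = 2 * 2 ^ (i - 1) := by
        rw [← pow_succ']; congr 1; omega
      rw [this, mul_assoc] at h
      exact Nat.eq_of_mul_eq_mul_left two_pos h
  · rintro ⟨i, j, rfl⟩
    exact ⟨i + 1, j, by ring⟩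

/-- `3L` is `3`-smooth iff `L` is. [folklore] -/
theorem isSmooth23_three_mul_iff (L : ℕ) : (∃ i j : ℕ, 3 * L = 2 ^ i * 3 ^ j) ↔ (∃ i j : ℕ, L = 2 ^ i * 3 ^ j) := by
  constructor
  · rintro ⟨i, j, h⟩
    rcases Nat.eq_zero_or_pos j with rfl | hj
    · exfalso
      have h3 : 3 ∣ 2 ^ i := ⟨L, by simpa [mul_comm] using h.symm⟩
      have := Nat.Prime.dvd_of_dvd_pow Nat.prime_three h3
      omega
    · refine ⟨i, j - 1, ?_⟩
      have : 3 ^ j = 3 * 3 ^ (j - 1) := by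
        rw [← pow_succ']; congr 1; omega
      rw [this, mul_left_comm] at h
      exact Nat.eq_of_mul_eq_mul_left (by norm_num) h
  · rintro ⟨i, j, rfl⟩
    exact ⟨i, j + 1, by ring⟩

/-- `5·2^k` is not `3`-smooth. [folklore] -/
theorem not_isSmooth23_five_mul_two_pow (k : ℕ) : ¬ ∃ i j : ℕ, 5 * 2 ^ k = 2 ^ i * 3 ^ j := by
  rintro ⟨i, j, h⟩
  have h5 : 5 ∣ 2 ^ i * 3 ^ j := ⟨2 ^ k, by rw [← h]⟩
  rcases (Nat.Prime.dvd_mul Nat.prime_five).1 h5 with h2 | h3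
  · have := Nat.Prime.dvd_of_dvd_pow Nat.prime_five h2; omega
  · have := Nat.Prime.dvd_of_dvd_pow Nat.prime_five h3; omega

/-- **Witness for mutation 2.** A `{0,1}`-valued sequence exactly invariant under BOTH `L ↦ 2L` and
`L ↦ 3L` that does not converge: the indicator of `{2^i 3^j}`. [folklore] -/
theorem exists_twoThreeInvariant_divergent : ∃ R : ℕ → ℝ,
    (∀ L : ℕ, R L = 0 ∨ R L = 1) ∧ (∀ L : ℕ, R (2 * L) = R L) ∧ (∀ L : ℕ, R (3 * L) = R L) ∧
    ¬ ∃ M : ℝ, Tendsto R atTop (𝓝 M) := by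
  classical
  refine ⟨Set.indicator {L : ℕ | ∃ i j : ℕ, L = 2 ^ i * 3 ^ j} (fun _ => (1:ℝ)), fun L => ?_, fun L => ?_,
    fun L => ?_, ?_⟩
  · by_cases hL : L ∈ {L : ℕ | ∃ i j : ℕ, L = 2 ^ i * 3 ^ j}
    · exact Or.inr (Set.indicator_of_mem hL _)
    · exact Or.inl (Set.indicator_of_notMem hL _)
  · by_cases hL : L ∈ {L : ℕ | ∃ i j : ℕ, L = 2 ^ i * 3 ^ j}
    · rw [Set.indicator_of_mem hL, Set.indicator_of_mem (show 2 * L ∈ _ from (isSmooth23_two_mul_iff L).2 hL)]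
    · rw [Set.indicator_of_notMem hL,
        Set.indicator_of_notMem (show 2 * L ∉ _ from fun h => hL ((isSmooth23_two_mul_iff L).1 h))]
  · by_cases hL : L ∈ {L : ℕ | ∃ i j : ℕ, L = 2 ^ i * 3 ^ j}
    · rw [Set.indicator_of_mem hL, Set.indicator_of_mem (show 3 * L ∈ _ from (isSmooth23_three_mul_iff L).2 hL)]
    · rw [Set.indicator_of_notMem hL,
        Set.indicator_of_notMem (show 3 * L ∉ _ from fun h => hL ((isSmooth23_three_mul_iff L).1 h))]
  · rintro ⟨M, hM⟩
    have h1 := hM.comp (tendsto_pow_atTop_atTop_of_one_lt one_lt_two)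
    have h5 := hM.comp ((tendsto_pow_atTop_atTop_of_one_lt one_lt_two).const_mul_atTop' (by norm_num : 0 < 5))
    have e1 : ∀ k : ℕ, Set.indicator {L : ℕ | ∃ i j : ℕ, L = 2 ^ i * 3 ^ j} (fun _ => (1:ℝ)) (2 ^ k) = 1 :=
      fun k => Set.indicator_of_mem
        (show 2 ^ k ∈ {L : ℕ | ∃ i j : ℕ, L = 2 ^ i * 3 ^ j} from ⟨k, 0, by simp⟩) _
    have e5 : ∀ k : ℕ, Set.indicator {L : ℕ | ∃ i j : ℕ, L = 2 ^ i * 3 ^ j} (fun _ => (1:ℝ)) (5 * 2 ^ k) = 0 :=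
      fun k => Set.indicator_of_notMem
        (show 5 * 2 ^ k ∉ {L : ℕ | ∃ i j : ℕ, L = 2 ^ i * 3 ^ j} from not_isSmooth23_five_mul_two_pow k) _
    have h1' : Tendsto (fun _ : ℕ => (1:ℝ)) atTop (𝓝 M) := h1.congr (fun k => e1 k)
    have h5' : Tendsto (fun _ : ℕ => (0:ℝ)) atTop (𝓝 M) := h5.congr (fun k => e5 k)
    have := (tendsto_const_nhds_iff.1 h1').trans (tendsto_const_nhds_iff.1 h5').symm
    norm_num at this

/-- **Mutation 2 is false: log-continuity is load-bearing.** The two-base Croft lemma with the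
log-continuity hypothesis dropped fails, even with BOTH towers exactly invariant (rate `0`): power-rate
tower bounds for `2` AND `3` at every base point force nothing on a bare sequence. [folklore] -/
theorem not_twoBaseCroft_without_logContinuity :
    ¬ (∀ R : ℕ → ℝ, (∃ C θ : ℝ, 0 < θ ∧ ∀ L : ℕ, 1 ≤ L →
        |R (2*L) - R L| ≤ C * (L:ℝ)^(-θ) ∧ |R (3*L) - R L| ≤ C * (L:ℝ)^(-θ)) →
        ∃ M : ℝ, Tendsto R atTop (𝓝 M)) := by
  intro h
  obtain ⟨R, -, h2, h3, hdiv⟩ := exists_twoThreeInvariant_divergent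
  exact hdiv (h R ⟨0, 1, one_pos, fun L _ => ⟨by rw [h2 L, sub_self, abs_zero, zero_mul],
    by rw [h3 L, sub_self, abs_zero, zero_mul]⟩⟩)

/-! ### Mutation 3 — power rate weakened to `o(1)` steps: `cos (π √(log₂ L))` -/

/-- `√t' − √t ≤ t' − t` for `1 ≤ t ≤ t'`. [folklore] -/
theorem sqrt_sub_sqrt_le {t t' : ℝ} (ht : 1 ≤ t) (htt' : t ≤ t') :
    Real.sqrt t' - Real.sqrt t ≤ t' - t := by
  have hu : 1 ≤ Real.sqrt t := by simpa using Real.sqrt_le_sqrt ht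
  have hv : Real.sqrt t ≤ Real.sqrt t' := Real.sqrt_le_sqrt htt'
  have ht0 : 0 ≤ t := by linarith
  have ht'0 : 0 ≤ t' := by linarith
  nlinarith [Real.sq_sqrt ht0, Real.sq_sqrt ht'0]

/-- `1 ≤ log₂ L` for `L ≥ 2`. [folklore] -/
theorem one_le_logb_two {L : ℕ} (hL : 2 ≤ L) : 1 ≤ Real.logb 2 (L:ℝ) := by
  have hL0 : (0:ℝ) < L := by exact_mod_cast (lt_of_lt_of_le two_pos hL)
  rw [Real.le_logb_iff_rpow_le one_lt_two hL0, Real.rpow_one]; exact_mod_cast hL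

/-- The basic increment bound for `cos (π √(log₂ ·))` on `2 ≤ L ≤ L'`. [folklore] -/
theorem abs_cosSqrtLog_sub_le {L L' : ℕ} (hL : 2 ≤ L) (hLL' : L ≤ L') :
    |Real.cos (Real.pi * Real.sqrt (Real.logb 2 (L':ℝ))) - Real.cos (Real.pi * Real.sqrt (Real.logb 2 (L:ℝ)))|
      ≤ Real.pi * (Real.sqrt (Real.logb 2 L') - Real.sqrt (Real.logb 2 L)) := by
  have hL0 : (0:ℝ) < L := by exact_mod_cast (lt_of_lt_of_le two_pos hL)
  have htt' : Real.logb 2 (L:ℝ) ≤ Real.logb 2 (L':ℝ) :=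
    Real.logb_le_logb_of_le one_lt_two hL0 (by exact_mod_cast hLL')
  calc |Real.cos (Real.pi * Real.sqrt (Real.logb 2 L')) - Real.cos (Real.pi * Real.sqrt (Real.logb 2 L))|
      ≤ |Real.pi * Real.sqrt (Real.logb 2 L') - Real.pi * Real.sqrt (Real.logb 2 L)| :=
        Real.abs_cos_sub_cos_le _ _
    _ = Real.pi * (Real.sqrt (Real.logb 2 L') - Real.sqrt (Real.logb 2 L)) := by
        rw [← mul_sub, abs_of_nonneg (mul_nonneg Real.pi_pos.le (sub_nonneg.2 (Real.sqrt_le_sqrt htt')))]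

/-- Log-continuity of `cos (π √(log₂ ·))`. [folklore] -/
theorem cosSqrtLog_logContinuous : ∀ ε : ℝ, 0 < ε → ∃ s : ℝ, 0 < s ∧ ∃ L₀ : ℕ, ∀ L L' : ℕ, L₀ ≤ L → L ≤ L' →
    (L':ℝ) ≤ (1+s)*L → |Real.cos (Real.pi * Real.sqrt (Real.logb 2 (L':ℝ))) -
      Real.cos (Real.pi * Real.sqrt (Real.logb 2 (L:ℝ)))| ≤ ε := by
  intro ε hε
  refine ⟨ε / 10, by positivity, 2, fun L L' hL hLL' hL's => ?_⟩
  have hL0 : (0:ℝ) < L := by exact_mod_cast (lt_of_lt_of_le two_pos hL)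
  have htt' : Real.logb 2 (L:ℝ) ≤ Real.logb 2 (L':ℝ) :=
    Real.logb_le_logb_of_le one_lt_two hL0 (by exact_mod_cast hLL')
  refine (abs_cosSqrtLog_sub_le hL hLL').trans ?_
  calc Real.pi * (Real.sqrt (Real.logb 2 L') - Real.sqrt (Real.logb 2 L))
      ≤ Real.pi * (Real.logb 2 L' - Real.logb 2 L) :=
        mul_le_mul_of_nonneg_left (sqrt_sub_sqrt_le (one_le_logb_two hL) htt') Real.pi_pos.le
    _ ≤ Real.pi * ((ε / 10) / Real.log 2) :=
        mul_le_mul_of_nonneg_left (logb_two_window_le (by positivity) (le_trans one_le_two hL) hLL' hL's)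
          Real.pi_pos.le
    _ ≤ ε := by
        have hlog2 : (0.6931471803:ℝ) < Real.log 2 := Real.log_two_gt_d9
        have hπ : Real.pi < 3.15 := Real.pi_lt_d2
        rw [mul_div_assoc', div_le_iff₀ (Real.log_pos one_lt_two)]
        nlinarith [Real.pi_pos]

/-- Single `p`-steps of `cos (π √(log₂ ·))` are `o(1)`, for EVERY base `p ≥ 1`. [folklore] -/
theorem tendsto_cosSqrtLog_step (p : ℕ) (hp : 1 ≤ p) :
    Tendsto (fun L : ℕ => Real.cos (Real.pi * Real.sqrt (Real.logb 2 ((p * L : ℕ) : ℝ))) -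
      Real.cos (Real.pi * Real.sqrt (Real.logb 2 (L:ℝ)))) atTop (𝓝 0) := by
  have hp0 : (0:ℝ) < p := by exact_mod_cast hp
  have hap : 0 ≤ Real.logb 2 (p:ℝ) := Real.logb_nonneg one_lt_two (by exact_mod_cast hp)
  have hbound : ∀ᶠ L : ℕ in atTop, |Real.cos (Real.pi * Real.sqrt (Real.logb 2 ((p * L : ℕ) : ℝ))) -
      Real.cos (Real.pi * Real.sqrt (Real.logb 2 (L:ℝ)))| ≤
      Real.pi * Real.logb 2 p * (Real.sqrt (Real.logb 2 L))⁻¹ := by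
    filter_upwards [eventually_ge_atTop 2] with L hL
    have hL0 : (0:ℝ) < L := by exact_mod_cast (lt_of_lt_of_le two_pos hL)
    have ht : 1 ≤ Real.logb 2 (L:ℝ) := one_le_logb_two hL
    have ha : Real.logb 2 ((p * L : ℕ):ℝ) = Real.logb 2 p + Real.logb 2 L := by
      rw [Nat.cast_mul, Real.logb_mul hp0.ne' hL0.ne']
    refine (abs_cosSqrtLog_sub_le hL (Nat.le_mul_of_pos_left L hp)).trans ?_
    rw [mul_assoc]
    refine mul_le_mul_of_nonneg_left ?_ Real.pi_pos.le
    rw [ha]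
    set t := Real.logb 2 (L:ℝ) with ht_def
    set a := Real.logb 2 (p:ℝ) with ha_def
    have hst : 0 < Real.sqrt t := Real.sqrt_pos.2 (by linarith)
    rw [← div_eq_mul_inv, le_div_iff₀ hst]
    have h1 : 0 ≤ t := by linarith
    have h2 : 0 ≤ a + t := by linarith
    nlinarith [Real.sq_sqrt h1, Real.sq_sqrt h2, Real.sqrt_nonneg (a + t),
      Real.sqrt_le_sqrt (le_add_of_nonneg_left hap : t ≤ a + t)]
  have hsqrt : Tendsto Real.sqrt atTop atTop := by
    refine Filter.tendsto_atTop_atTop.2 fun b => ⟨b ^ 2, fun x hx => ?_⟩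
    calc b ≤ |b| := le_abs_self b
      _ = Real.sqrt (b ^ 2) := (Real.sqrt_sq_eq_abs b).symm
      _ ≤ Real.sqrt x := Real.sqrt_le_sqrt hx
  have hlim : Tendsto (fun L : ℕ => Real.pi * Real.logb 2 p * (Real.sqrt (Real.logb 2 L))⁻¹) atTop (𝓝 0) := by
    have h := ((hsqrt.comp ((Real.tendsto_logb_atTop one_lt_two).comp
      tendsto_natCast_atTop_atTop)).inv_tendsto_atTop).const_mul (Real.pi * Real.logb 2 p)
    simpa using h
  exact squeeze_zero_norm' hbound hlim

/-- Value `(−1)ⁿ = cos (π n)` at `L = 2^{n²}`. [folklore] -/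
theorem cosSqrtLog_two_pow_sq (n : ℕ) :
    Real.cos (Real.pi * Real.sqrt (Real.logb 2 ((2 ^ (n ^ 2) : ℕ) : ℝ))) = Real.cos (Real.pi * n) := by
  rw [Nat.cast_pow, Nat.cast_ofNat, Real.logb_pow, Real.logb_self_eq_one one_lt_two, mul_one,
    Nat.cast_pow, Real.sqrt_sq (Nat.cast_nonneg n)]

/-- `2^{(2k)²} → ∞`. [folklore] -/
theorem tendsto_two_pow_sq_even : Tendsto (fun k : ℕ => 2 ^ ((2 * k) ^ 2)) atTop atTop := by
  refine tendsto_atTop_mono (fun k => ?_) tendsto_id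
  calc id k = k := rfl
    _ ≤ (2 * k) ^ 2 := by nlinarith
    _ ≤ 2 ^ ((2 * k) ^ 2) := Nat.lt_two_pow_self.le

/-- `2^{(2k+1)²} → ∞`. [folklore] -/
theorem tendsto_two_pow_sq_odd : Tendsto (fun k : ℕ => 2 ^ ((2 * k + 1) ^ 2)) atTop atTop := by
  refine tendsto_atTop_mono (fun k => ?_) tendsto_id
  calc id k = k := rfl
    _ ≤ (2 * k + 1) ^ 2 := by nlinarith
    _ ≤ 2 ^ ((2 * k + 1) ^ 2) := Nat.lt_two_pow_self.le

/-- **Witness for mutation 3.** A bounded, log-continuous real sequence whose single steps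
`R(pL) − R(L)` are `o(1)` for EVERY base `p ≥ 1`, and which does not converge:
`R L = cos (π √(log₂ L))` (`R(2^{n²}) = (−1)ⁿ`). [folklore] -/
theorem exists_littleO_steps_logContinuous_divergent : ∃ R : ℕ → ℝ,
    (∀ L : ℕ, |R L| ≤ 1) ∧ (∀ p : ℕ, 1 ≤ p → Tendsto (fun L : ℕ => R (p * L) - R L) atTop (𝓝 0)) ∧
    (∀ ε : ℝ, 0 < ε → ∃ s : ℝ, 0 < s ∧ ∃ L₀ : ℕ, ∀ L L' : ℕ, L₀ ≤ L → L ≤ L' → (L':ℝ) ≤ (1+s)*L →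
      |R L' - R L| ≤ ε) ∧
    ¬ ∃ M : ℝ, Tendsto R atTop (𝓝 M) := by
  refine ⟨fun L => Real.cos (Real.pi * Real.sqrt (Real.logb 2 (L:ℝ))), fun L => Real.abs_cos_le_one _,
    tendsto_cosSqrtLog_step, cosSqrtLog_logContinuous, ?_⟩
  rintro ⟨M, hM⟩
  have he := hM.comp tendsto_two_pow_sq_even
  have ho := hM.comp tendsto_two_pow_sq_odd
  have he' : ∀ k : ℕ, Real.cos (Real.pi * Real.sqrt (Real.logb 2 ((2 ^ ((2 * k) ^ 2) : ℕ) : ℝ))) = 1 := fun k => by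
    rw [cosSqrtLog_two_pow_sq, show Real.pi * ((2 * k : ℕ) : ℝ) = (k:ℝ) * (2 * Real.pi) by push_cast; ring]
    exact Real.cos_nat_mul_two_pi k
  have ho' : ∀ k : ℕ, Real.cos (Real.pi * Real.sqrt (Real.logb 2 ((2 ^ ((2 * k + 1) ^ 2) : ℕ) : ℝ))) = -1 :=
    fun k => by
    rw [cosSqrtLog_two_pow_sq,
      show Real.pi * ((2 * k + 1 : ℕ) : ℝ) = (k:ℝ) * (2 * Real.pi) + Real.pi by push_cast; ring]
    exact Real.cos_nat_mul_two_pi_add_pi k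
  have h1 : Tendsto (fun _ : ℕ => (1:ℝ)) atTop (𝓝 M) := he.congr (fun k => he' k)
  have h2 : Tendsto (fun _ : ℕ => (-1:ℝ)) atTop (𝓝 M) := ho.congr (fun k => ho' k)
  have := (tendsto_const_nhds_iff.1 h1).trans (tendsto_const_nhds_iff.1 h2).symm
  norm_num at this

/-- **Mutation 3 is false: the power rate is load-bearing.** The two-base Croft lemma with the rate
`C·L^{-θ}` of both towers weakened to `o(1)` single steps fails, even with log-continuity and with
`o(1)` steps for every base simultaneously. [folklore] -/
theorem not_twoBaseCroft_littleO :
    ¬ (∀ R : ℕ → ℝ, Tendsto (fun L : ℕ => R (2 * L) - R L) atTop (𝓝 0) →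
        Tendsto (fun L : ℕ => R (3 * L) - R L) atTop (𝓝 0) →
        (∀ ε : ℝ, 0 < ε → ∃ s : ℝ, 0 < s ∧ ∃ L₀ : ℕ, ∀ L L' : ℕ, L₀ ≤ L → L ≤ L' → (L':ℝ) ≤ (1+s)*L →
          |R L' - R L| ≤ ε) →
        ∃ M : ℝ, Tendsto R atTop (𝓝 M)) := by
  intro h
  obtain ⟨R, -, hstep, hLC, hdiv⟩ := exists_littleO_steps_logContinuous_divergent
  exact hdiv (h R (hstep 2 (by norm_num)) (hstep 3 (by norm_num)) hLC)

end Summit.CriticalPhenomena.Ising3DConformalLimit.JoiningsTransferNegative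

end
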